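import Mathlib
import HarnessLib.Audit
import Summits.PneNP.PneNP.Theorems.PstarCrossBudget

/-!
# The blind free CROSS gate: the budget with a SET OF CARRIERS (pendant gates of the constraints read inside the core) (O2 / E1; prover-1 g22)

FRONTIER range-avoidance ladder, rung F-N3 (`stmt-PneNP-19007`), cell `pnp-ideate`; restricted-model proof complexity — nothing here bears on `P` versus `NP`.

Cross data `B` (`PstarCrossData.CrossData I r B e_p e_q g₀`).  The boundary count of `PstarCrossBudget.cross_budget` on the larger family
`X = O ∪ {g₀} ∪ J₀` for a finite set `O ⊆ G₁ ∪ G₂` of further monomial outputs ("carriers") each with BOTH AND variables read inside `J₀`: every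
`o ∈ O` pays at most its two XOR slots, so `(r, 3/2)`-expansion reads

* `cross_budget_carriers` — **`#(J₀ ∖ N) + 3 ≤ #N + #O + 2·#Pv`**, `Pv` = the tree edges both of whose AND variables are private within `X`
  (for `O = ∅` this is `cross_budget`; E2 analogue: `PstarGateBudgetCrosses.gate_budget_crosses`).
This is the count that kills the PIN rows of the nodes (`PstarCrossCasePEmptyGeneric`, `PstarCrossCaseU2Clean` leave exactly the rows in which a constraint
touches private tree edges through carriers; each touched edge leaves `Pv`, each carrier adds one to `#O`).
-/

set_option linter.dupNamespace false -- `Summit.PneNP.PneNP.…`: summit = sub-problem name (D-0017 single-conjunct layout)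

open Finset Literature.Computability.Complexity
open Summit.PneNP.PneNP.Theorems.PstarSALevel (varSet bdry BoundaryExpanding SimpleOverlap)
open Summit.PneNP.PneNP.Theorems.PstarCentreFree (vars_mem_varSet)
open Summit.PneNP.PneNP.Theorems.PstarXCore (xverts)
open Summit.PneNP.PneNP.Theorems.PstarCoreBound (XorClosed)
open Summit.PneNP.PneNP.Theorems.PstarChordBridgeTools (privs mem_privs vars_mem_privs)
open Summit.PneNP.PneNP.Theorems.PstarChordBridge (BridgeData)
open Summit.PneNP.PneNP.Theorems.PstarNorCoreTools (not_mem_bdry_of_two card_varSet_inter_bdry_le card_bdry_le_sum)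
open Summit.PneNP.PneNP.Theorems.PstarGateCasePNorHolders (not_mem_bdry_of_closed card_three_slots)
open Summit.PneNP.PneNP.Theorems.PstarCrossData (CrossData)

namespace Summit.PneNP.PneNP.Theorems.PstarCrossBudgetCarriers

variable {n m : ℕ}

/-- **The cross budget with carriers.**  See the module docstring. -/
theorem cross_budget_carriers (I : LocalMap 4 n m) {r₀ : ℕ} (hB : BoundaryExpanding r₀ I) {B : BridgeData n m} {e_p e_q g₀ : Fin m}
    (hD : CrossData I r₀ B e_p e_q g₀) {O : Finset (Fin m)} (hO : O ⊆ B.G₁ ∪ B.G₂) (hOJ : Disjoint O B.J₀) (hOg : g₀ ∉ O)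
    (hold : ∀ o ∈ O, (∃ j ∈ B.J₀, I.vars o 2 ∈ varSet I j) ∧ (∃ j ∈ B.J₀, I.vars o 3 ∈ varSet I j)) :
    ∃ Pv ⊆ B.J₀ \ B.N,
      (∀ j ∈ Pv, ∀ j' ∈ O ∪ insert g₀ B.J₀, j' ≠ j → I.vars j 2 ∉ varSet I j' ∧ I.vars j 3 ∉ varSet I j') ∧
      (B.J₀ \ B.N).card + 3 ≤ B.N.card + O.card + 2 * Pv.card := by
  classical
  have hW := hD.wf
  have hXc := hD.closed
  have hpN : e_p ∈ B.N := hD.mem_p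
  have hqN : e_q ∈ B.N := hD.mem_q
  have hpJ : e_p ∈ B.J₀ := hW.hN hpN
  have hqJ : e_q ∈ B.J₀ := hW.hN hqN
  have hg₀J : g₀ ∉ B.J₀ := fun h => disjoint_left.1 hD.disj₁ (mem_insert_self g₀ B.G₁) h
  set F := B.J₀ \ B.N with hFdef
  have hFJ : F ⊆ B.J₀ := sdiff_subset
  set X : Finset (Fin m) := O ∪ insert g₀ B.J₀ with hXdef
  set Pv := F.filter (fun j => ∀ j' ∈ X, j' ≠ j → I.vars j 2 ∉ varSet I j' ∧ I.vars j 3 ∉ varSet I j') with hPv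
  refine ⟨Pv, filter_subset _ _, fun j hj => (mem_filter.1 hj).2, ?_⟩
  have hJX : B.J₀ ⊆ X := (subset_insert _ _).trans subset_union_right
  have hg₀X : g₀ ∈ X := mem_union_right _ (mem_insert_self _ _)
  have hOdisj : Disjoint O (insert g₀ B.J₀) := by
    rw [disjoint_insert_right]; exact ⟨hOg, hOJ⟩
  have hXr : X.card ≤ r₀ := by
    refine (card_le_card ?_).trans hD.rad
    refine union_subset (fun o ho => ?_)
      (insert_subset (mem_union_left _ (mem_union_right _ (mem_insert_self g₀ B.G₁))) (subset_union_left.trans subset_union_left))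
    rcases mem_union.1 (hO ho) with h | h
    · exact mem_union_left _ (mem_union_right _ (mem_insert_of_mem h))
    · exact mem_union_right _ h
  have hXcard : X.card = O.card + (B.J₀.card + 1) := by
    rw [hXdef, card_union_of_disjoint hOdisj, card_insert_of_notMem hg₀J]
  have hg₀_p : I.vars g₀ 2 ∈ varSet I e_p := by rw [hD.gate_vars.1]; exact vars_mem_varSet I e_p 2
  have hg₀_q : I.vars g₀ 3 ∈ varSet I e_q := by rw [hD.gate_vars.2]; exact vars_mem_varSet I e_q 2
  have hp_g₀ : I.vars e_p 2 ∈ varSet I g₀ := hD.gate_vars.1 ▸ vars_mem_varSet I g₀ 2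
  have hq_g₀ : I.vars e_q 2 ∈ varSet I g₀ := hD.gate_vars.2 ▸ vars_mem_varSet I g₀ 3
  have hOJ' : ∀ o ∈ O, o ∉ B.J₀ := fun o ho h => disjoint_left.1 hOJ ho h
  -- per-output budgets
  let q : Fin m → ℕ := fun k =>
    if k ∈ O then 2 else if k = g₀ then 2 else if k ∈ (B.N.erase e_p).erase e_q then 2 else if k ∈ Pv then 2 else 1
  have htwo : ∀ k ∈ X, k ∈ B.J₀ → (varSet I k ∩ bdry I X).card ≤ 2 := by
    intro k hk hkJ
    have h := card_varSet_inter_bdry_le I X k {0, 1} (fun s hs => by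
      simp only [mem_insert, mem_singleton] at hs
      rcases hs with rfl | rfl
      · exact not_mem_bdry_of_closed I hXc hJX hkJ (by decide)
      · exact not_mem_bdry_of_closed I hXc hJX hkJ (by decide))
    have h2 : ({0, 1} : Finset (Fin 4)).card = 2 := by decide
    rw [h2] at h; exact h
  have hq : ∀ k ∈ X, (varSet I k ∩ bdry I X).card ≤ q k := by
    intro k hk
    by_cases hko : k ∈ O
    · simp only [q, if_pos hko]
      obtain ⟨⟨j2, hj2, hv2⟩, ⟨j3, hj3, hv3⟩⟩ := hold k hko
      have h := card_varSet_inter_bdry_le I X k {2, 3} (fun s hs => by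
        simp only [mem_insert, mem_singleton] at hs
        rcases hs with rfl | rfl
        · exact not_mem_bdry_of_two I hk (hJX hj2) (fun h => hOJ' k hko (h ▸ hj2)) (vars_mem_varSet I k 2) hv2
        · exact not_mem_bdry_of_two I hk (hJX hj3) (fun h => hOJ' k hko (h ▸ hj3)) (vars_mem_varSet I k 3) hv3)
      have h2 : ({2, 3} : Finset (Fin 4)).card = 2 := by decide
      rw [h2] at h; exact h
    by_cases hkg₀ : k = g₀
    · subst hkg₀
      simp only [q, if_neg hko, if_true]
      have h := card_varSet_inter_bdry_le I X k {2, 3} (fun s hs => by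
        simp only [mem_insert, mem_singleton] at hs
        rcases hs with rfl | rfl
        · exact not_mem_bdry_of_two I hk (hJX hpJ) (fun h => hg₀J (h ▸ hpJ)) (vars_mem_varSet I k 2) hg₀_p
        · exact not_mem_bdry_of_two I hk (hJX hqJ) (fun h => hg₀J (h ▸ hqJ)) (vars_mem_varSet I k 3) hg₀_q)
      have h2 : ({2, 3} : Finset (Fin 4)).card = 2 := by decide
      rw [h2] at h; exact h
    have hkJ : k ∈ B.J₀ := by
      rw [hXdef, mem_union, mem_insert] at hk
      rcases hk with h | h | h
      · exact absurd h hko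
      · exact absurd h hkg₀
      · exact h
    by_cases hkN : k ∈ (B.N.erase e_p).erase e_q
    · simp only [q, if_neg hko, if_neg hkg₀, if_pos hkN]
      exact htwo k hk hkJ
    by_cases hkP : k ∈ Pv
    · simp only [q, if_neg hko, if_neg hkg₀, if_neg hkN, if_pos hkP]
      exact htwo k hk hkJ
    · simp only [q, if_neg hko, if_neg hkg₀, if_neg hkN, if_neg hkP]
      obtain ⟨s, hs2, k', hk', hne', hv⟩ : ∃ s : Fin 4, 2 ≤ s.val ∧ ∃ k' ∈ X, k' ≠ k ∧ I.vars k s ∈ varSet I k' := by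
        by_cases hkp : k = e_p
        · subst hkp
          exact ⟨2, by decide, g₀, hg₀X, fun h => hg₀J (h ▸ hpJ), hp_g₀⟩
        by_cases hkq : k = e_q
        · subst hkq
          exact ⟨2, by decide, g₀, hg₀X, fun h => hg₀J (h ▸ hqJ), hq_g₀⟩
        have hkF : k ∈ F := mem_sdiff.2 ⟨hkJ, fun hkN' => hkN (mem_erase.2 ⟨hkq, mem_erase.2 ⟨hkp, hkN'⟩⟩)⟩
        have hnp : ¬ ∀ j' ∈ X, j' ≠ k → I.vars k 2 ∉ varSet I j' ∧ I.vars k 3 ∉ varSet I j' :=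
          fun h => hkP (mem_filter.2 ⟨hkF, h⟩)
        push Not at hnp
        obtain ⟨j', hj'X, hj'k, hj'⟩ := hnp
        by_cases h2 : I.vars k 2 ∈ varSet I j'
        · exact ⟨2, by decide, j', hj'X, hj'k, h2⟩
        · exact ⟨3, by decide, j', hj'X, hj'k, hj' h2⟩
      have h := card_varSet_inter_bdry_le I X k {0, 1, s} (fun s' hs' => by
        simp only [mem_insert, mem_singleton] at hs'
        rcases hs' with rfl | rfl | rfl
        · exact not_mem_bdry_of_closed I hXc hJX hkJ (by decide)
        · exact not_mem_bdry_of_closed I hXc hJX hkJ (by decide)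
        · exact not_mem_bdry_of_two I hk hk' (Ne.symm hne') (vars_mem_varSet I k s') hv)
      rw [card_three_slots hs2] at h
      exact h
  have hbd := card_bdry_le_sum I X q hq
  -- evaluate the sum over `X = O ⊔ {g₀} ⊔ N ⊔ F`
  have hqg₀ : q g₀ = 2 := by
    show (if g₀ ∈ O then 2 else if g₀ = g₀ then 2 else if g₀ ∈ (B.N.erase e_p).erase e_q then 2 else if g₀ ∈ Pv then 2 else 1) = 2
    rw [if_neg hOg, if_pos rfl]
  have hJsplit : B.J₀ = B.N ∪ F := by rw [hFdef, union_sdiff_of_subset hW.hN]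
  have hdisj : Disjoint B.N F := by rw [hFdef]; exact disjoint_sdiff
  have hqpe : e_q ∈ B.N.erase e_p := mem_erase.2 ⟨hD.ne.symm, hqN⟩
  have hsumO : ∑ k ∈ O, q k = 2 * O.card := by
    rw [mul_comm, card_eq_sum_ones, sum_mul]
    refine sum_congr rfl fun k hk => ?_
    show (if k ∈ O then 2 else if k = g₀ then 2 else if k ∈ (B.N.erase e_p).erase e_q then 2 else if k ∈ Pv then 2 else 1) = 1 * 2
    rw [if_pos hk, one_mul]
  have hsumN : ∑ k ∈ B.N, q k = 2 + 2 * ((B.N.erase e_p).erase e_q).card := by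
    rw [← add_sum_erase B.N q hpN, ← add_sum_erase _ q hqpe]
    have hpg₀ : e_p ≠ g₀ := fun h => hg₀J (h ▸ hpJ)
    have hqg₀ : e_q ≠ g₀ := fun h => hg₀J (h ▸ hqJ)
    have hpP : e_p ∉ Pv := fun h => (mem_sdiff.1 (mem_filter.1 h).1).2 hpN
    have hqP : e_q ∉ Pv := fun h => (mem_sdiff.1 (mem_filter.1 h).1).2 hqN
    have hpO : e_p ∉ O := fun h => hOJ' e_p h hpJ
    have hqO : e_q ∉ O := fun h => hOJ' e_q h hqJ
    have hpN' : e_p ∉ (B.N.erase e_p).erase e_q := fun h => (notMem_erase e_p B.N) (mem_of_mem_erase h)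
    have hqe : q e_p = 1 := by
      show (if e_p ∈ O then 2 else if e_p = g₀ then 2 else if e_p ∈ (B.N.erase e_p).erase e_q then 2 else if e_p ∈ Pv then 2 else 1) = 1
      rw [if_neg hpO, if_neg hpg₀, if_neg hpN', if_neg hpP]
    have hqe' : q e_q = 1 := by
      show (if e_q ∈ O then 2 else if e_q = g₀ then 2 else if e_q ∈ (B.N.erase e_p).erase e_q then 2 else if e_q ∈ Pv then 2 else 1) = 1
      rw [if_neg hqO, if_neg hqg₀, if_neg (notMem_erase e_q _), if_neg hqP]
    rw [hqe, hqe', ← add_assoc, mul_comm, card_eq_sum_ones, sum_mul]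
    congr 1
    refine sum_congr rfl fun k hk => ?_
    have hkJ : k ∈ B.J₀ := hW.hN (mem_of_mem_erase (mem_of_mem_erase hk))
    have hkg₀ : k ≠ g₀ := fun h => hg₀J (h ▸ hkJ)
    have hko : k ∉ O := fun h => hOJ' k h hkJ
    show (if k ∈ O then 2 else if k = g₀ then 2 else if k ∈ (B.N.erase e_p).erase e_q then 2 else if k ∈ Pv then 2 else 1) = 1 * 2
    rw [if_neg hko, if_neg hkg₀, if_pos hk, one_mul]
  have hsumF : ∑ k ∈ F, q k = F.card + Pv.card := by
    have hsplit := (sum_filter_add_sum_filter_not F (fun k => k ∈ Pv) q).symm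
    have hf1 : F.filter (fun k => k ∈ Pv) = Pv := by
      ext k
      simp only [mem_filter]
      exact ⟨fun h => h.2, fun h => ⟨(mem_filter.1 h).1, h⟩⟩
    rw [hsplit, hf1]
    have hFN' : ∀ k ∈ F, k ∉ (B.N.erase e_p).erase e_q := fun k hkF h =>
      (mem_sdiff.1 hkF).2 (mem_of_mem_erase (mem_of_mem_erase h))
    have h1 : ∑ k ∈ Pv, q k = 2 * Pv.card := by
      rw [mul_comm, card_eq_sum_ones, sum_mul]
      refine sum_congr rfl fun k hk => ?_
      have hkF := (mem_filter.1 hk).1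
      have hkg₀ : k ≠ g₀ := fun h => hg₀J (h ▸ hFJ hkF)
      have hko : k ∉ O := fun h => hOJ' k h (hFJ hkF)
      show (if k ∈ O then 2 else if k = g₀ then 2 else if k ∈ (B.N.erase e_p).erase e_q then 2 else if k ∈ Pv then 2 else 1) = 1 * 2
      rw [if_neg hko, if_neg hkg₀, if_neg (hFN' k hkF), if_pos hk, one_mul]
    have h2 : ∑ k ∈ F.filter (fun k => k ∉ Pv), q k = (F.filter (fun k => k ∉ Pv)).card := by
      rw [card_eq_sum_ones]
      refine sum_congr rfl fun k hk => ?_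
      obtain ⟨hkF, hkP⟩ := mem_filter.1 hk
      have hkg₀ : k ≠ g₀ := fun h => hg₀J (h ▸ hFJ hkF)
      have hko : k ∉ O := fun h => hOJ' k h (hFJ hkF)
      show (if k ∈ O then 2 else if k = g₀ then 2 else if k ∈ (B.N.erase e_p).erase e_q then 2 else if k ∈ Pv then 2 else 1) = 1
      rw [if_neg hko, if_neg hkg₀, if_neg (hFN' k hkF), if_neg hkP]
    rw [h1, h2]
    have hc := card_filter_add_card_filter_not (s := F) (fun k => k ∈ Pv)
    rw [hf1] at hc
    omega
  have hsumX : ∑ k ∈ X, q k = 2 * O.card + (2 + ((2 + 2 * ((B.N.erase e_p).erase e_q).card) + (F.card + Pv.card))) := by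
    rw [hXdef, sum_union hOdisj, sum_insert hg₀J, hsumO, hqg₀, hJsplit, sum_union hdisj, hsumN, hsumF]
  have hexp := hB X hXr
  rw [hXcard] at hexp
  rw [hsumX, card_erase_of_mem hqpe, card_erase_of_mem hpN] at hbd
  have hJcard : B.J₀.card = B.N.card + F.card := by rw [hJsplit, card_union_of_disjoint hdisj]
  have hN2 : 2 ≤ B.N.card := by
    have : ({e_p, e_q} : Finset (Fin m)) ⊆ B.N := insert_subset hpN (singleton_subset_iff.2 hqN)
    have h2 : ({e_p, e_q} : Finset (Fin m)).card = 2 := card_pair hD.ne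
    exact h2 ▸ card_le_card this
  omega

end Summit.PneNP.PneNP.Theorems.PstarCrossBudgetCarriers
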